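import Mathlib.Data.Matrix.Basis
import Mathlib.Data.ZMod.Basic
import Mathlib.LinearAlgebra.Dual.Defs
import Mathlib.Data.Nat.Bitwise
import HarnessLib

/-!
# ω-census family (a), GF(2) rank floors: bit-level coordinates for matrices and linear forms over `𝔽₂`

Cell `pub-omega` (HOME `run/shared/lean/pub/pub-omega/`, unit `pub-omega-lit`, gen 4), topic
`Summits/MatrixMultiplication/OmegaCensus` (sub-folder `SmallFormats`). Framing (verbatim): lottery ticket;
floor = certified bounds/negative ranges. HONEST FRAMING: replay INFRASTRUCTURE (coordinates) for kernel-checking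
independently regenerated Wang-2026-style rank-lower-bound certificates for `R_{𝔽₂}(⟨l,m,n⟩)` (design note
`pub-omega-lit/KERNEL-GF2-FLOORS-DESIGN.md` §7, layer R1); the mathematical soundness lives in
`Literature/…/SubstitutionBacktracking.lean`, `SingleProductExchange.lean`, `ConstrainedMatMulSandwich.lean`.
Nothing here is progress on `ω`. Everything is elementary and PROVED: an
`l × m` matrix over `𝔽₂ = ZMod 2` is encoded by a natural number whose bit `j + m i` is the entry
`(i, j)`; a linear form by the same encoding of its values on the standard basis; evaluation,
membership in a constraint subspace and matrix products become Boolean computations on the bits,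
which the kernel evaluates by `decide`.

* `bxor f N` — parity of `#{p < N | f p}`; `sum_ite_range` relates it to a sum in `ZMod 2`.
* `maskOf f N` — the number with bits `f p` (`p < N`); `testBit_maskOf`.
* `vecOf N x : Fin N → ZMod 2`, `ofBits l m x : Matrix (Fin l) (Fin m) (ZMod 2)` and the
  surjectivity statements `forall_vec_iff`, `forall_matrix_iff` (a universally quantified matrix
  statement is a bounded statement about naturals).
* `form l m κ` — the linear form with bit pattern `κ`; `form_ofBits` (evaluation = parity of the
  common bits, `bdot`), `forall_dual_iff` (every linear form is some `form l m κ`, `κ < 2^(l m)`),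
  `form_xor`.
* `mulBits`, `ofBits_mulBits` — matrix product in bits.

## References

* C. Wang, *Automated Lower Bounds for Bilinear Complexity over Finite Fields*, arXiv:2603.07280
  (2026), §7 (certificates and their verification). [Wang2026]
-/

namespace Summit.MatrixMultiplication.OmegaCensus.GF2RankLB

open Matrix

/-! ## Parity folds and masks -/

/-- Parity of the number of `p < N` with `f p`. -/
def bxor (f : ℕ → Bool) : ℕ → Bool
  | 0 => false
  | N + 1 => xor (bxor f N) (f N)

/-- `[a] + [b] = [a xor b]` in `ZMod 2`. -/
theorem ite_add_ite (a b : Bool) :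
    ((if a then (1 : ZMod 2) else 0) + if b then 1 else 0) = if xor a b then 1 else 0 := by
  cases a <;> cases b <;> decide

/-- In `ZMod 2`, `∑_{p < N} [f p] = [bxor f N]`. -/
theorem sum_ite_range (f : ℕ → Bool) (N : ℕ) :
    (∑ p ∈ Finset.range N, (if f p then (1 : ZMod 2) else 0)) = if bxor f N then 1 else 0 := by
  induction N with
  | zero => simp [bxor]
  | succ N ih =>
    rw [Finset.sum_range_succ, ih, ite_add_ite]
    rfl

/-- The natural number with bit `p` equal to `f p` for `p < N` (and `0` above). -/
def maskOf (f : ℕ → Bool) : ℕ → ℕ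
  | 0 => 0
  | N + 1 => maskOf f N + if f N then 2 ^ N else 0

/-- `maskOf f N < 2 ^ N`. -/
theorem maskOf_lt (f : ℕ → Bool) : ∀ N, maskOf f N < 2 ^ N
  | 0 => by simp [maskOf]
  | N + 1 => by
    have := maskOf_lt f N
    simp only [maskOf, pow_succ]
    split <;> omega

/-- The bits of `maskOf`. -/
theorem testBit_maskOf (f : ℕ → Bool) : ∀ N p, (maskOf f N).testBit p = (decide (p < N) && f p)
  | 0, p => by simp [maskOf]
  | N + 1, p => by
    simp only [maskOf]
    have hlt := maskOf_lt f N
    by_cases hf : f N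
    · rw [if_pos hf, add_comm]
      rcases lt_trichotomy p N with h | rfl | h
      · rw [Nat.testBit_two_pow_add_gt h, testBit_maskOf f N p]
        simp [h, Nat.lt_succ_of_lt h]
      · rw [Nat.testBit_two_pow_add_eq, testBit_maskOf f p p]
        simp [hf]
      · have h2 : 2 ^ N + maskOf f N < 2 ^ p := by
          calc 2 ^ N + maskOf f N < 2 ^ N + 2 ^ N := by omega
            _ = 2 ^ (N + 1) := by rw [pow_succ]; ring
            _ ≤ 2 ^ p := Nat.pow_le_pow_right (by norm_num) h
        rw [Nat.testBit_lt_two_pow h2]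
        have : ¬ p < N + 1 := by omega
        simp [this]
    · rw [if_neg hf, add_zero, testBit_maskOf f N p]
      rcases lt_trichotomy p N with h | rfl | h
      · simp [h, Nat.lt_succ_of_lt h]
      · simp [hf]
      · have : ¬ p < N + 1 := by omega
        have h' : ¬ p < N := by omega
        simp [this, h']

/-! ## Vectors `Fin N → ZMod 2` -/

/-- Every element of `ZMod 2` is `0` or `1` (private copy; the landed twin lives in an unrelated
elliptic-curve file whose import would be disproportionate). -/
private theorem zmod2_eq_zero_or_one (a : ZMod 2) : a = 0 ∨ a = 1 := by
  fin_cases a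
  · exact Or.inl rfl
  · exact Or.inr rfl

/-- The vector with entries the bits of `x`. -/
def vecOf (N : ℕ) (x : ℕ) : Fin N → ZMod 2 := fun t => if x.testBit t then 1 else 0

/-- The number encoding a vector. -/
def bitsOfVec {N : ℕ} (v : Fin N → ZMod 2) : ℕ :=
  maskOf (fun p => if h : p < N then decide (v ⟨p, h⟩ = 1) else false) N

/-- `bitsOfVec v < 2 ^ N`. -/
theorem bitsOfVec_lt {N : ℕ} (v : Fin N → ZMod 2) : bitsOfVec v < 2 ^ N := maskOf_lt _ _

/-- Decoding the encoding gives the vector back. -/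
theorem vecOf_bitsOfVec {N : ℕ} (v : Fin N → ZMod 2) : vecOf N (bitsOfVec v) = v := by
  funext t
  simp only [vecOf, bitsOfVec, testBit_maskOf, t.2, decide_true, Bool.true_and]
  rcases zmod2_eq_zero_or_one (v t) with h | h <;> simp [h]

/-- A statement about all vectors `Fin N → ZMod 2` is a statement about all `x < 2 ^ N`. -/
theorem forall_vec_iff {N : ℕ} (P : (Fin N → ZMod 2) → Prop) :
    (∀ v, P v) ↔ ∀ x < 2 ^ N, P (vecOf N x) :=
  ⟨fun h x _ => h _, fun h v => by rw [← vecOf_bitsOfVec v]; exact h _ (bitsOfVec_lt v)⟩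

/-- `vecOf` of a `xor` is the sum. -/
theorem vecOf_xor (N x y : ℕ) : vecOf N (x ^^^ y) = vecOf N x + vecOf N y := by
  funext t
  simp only [vecOf, Nat.testBit_xor, Pi.add_apply]
  cases x.testBit t <;> cases y.testBit t <;> decide

/-- Two numbers below `2 ^ N` with the same vector are equal. -/
theorem eq_of_vecOf_eq {N x y : ℕ} (hx : x < 2 ^ N) (hy : y < 2 ^ N)
    (h : vecOf N x = vecOf N y) : x = y := by
  apply Nat.eq_of_testBit_eq
  intro p
  by_cases hp : p < N
  · have := congrFun h ⟨p, hp⟩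
    simp only [vecOf] at this
    cases h1 : x.testBit p <;> cases h2 : y.testBit p <;> simp [h1, h2] at this ⊢
  · have h2p : 2 ^ N ≤ 2 ^ p := Nat.pow_le_pow_right (by norm_num) (not_lt.mp hp)
    rw [Nat.testBit_lt_two_pow (lt_of_lt_of_le hx h2p),
      Nat.testBit_lt_two_pow (lt_of_lt_of_le hy h2p)]

/-! ## Matrices -/

/-- Bit position of the entry `(i, j)` of an `l × m` matrix: `j + m i` (the convention of
`finProdFinEquiv`). -/
abbrev pos (m i j : ℕ) : ℕ := j + m * i

/-- The `l × m` matrix over `𝔽₂` encoded by `x`. -/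
def ofBits (l m : ℕ) (x : ℕ) : Matrix (Fin l) (Fin m) (ZMod 2) :=
  Matrix.of fun i j => if x.testBit (pos m i j) then 1 else 0

/-- Entries of `ofBits`. -/
@[simp] theorem ofBits_apply (l m x : ℕ) (i : Fin l) (j : Fin m) :
    ofBits l m x i j = if x.testBit (pos m i j) then 1 else 0 := rfl

/-- The number encoding a matrix. -/
def bitsOfMat {l m : ℕ} (X : Matrix (Fin l) (Fin m) (ZMod 2)) : ℕ :=
  bitsOfVec (fun q : Fin (l * m) => X (finProdFinEquiv.symm q).1 (finProdFinEquiv.symm q).2)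

/-- `bitsOfMat X < 2 ^ (l m)`. -/
theorem bitsOfMat_lt {l m : ℕ} (X : Matrix (Fin l) (Fin m) (ZMod 2)) : bitsOfMat X < 2 ^ (l * m) :=
  bitsOfVec_lt _

/-- The position of `(i, j)` is the value of `finProdFinEquiv (i, j)`. -/
theorem pos_eq (l m : ℕ) (i : Fin l) (j : Fin m) :
    pos m i j = (finProdFinEquiv (i, j) : Fin (l * m)) := by
  simp [pos, finProdFinEquiv]

/-- Decoding the encoding gives the matrix back. -/
theorem ofBits_bitsOfMat {l m : ℕ} (X : Matrix (Fin l) (Fin m) (ZMod 2)) :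
    ofBits l m (bitsOfMat X) = X := by
  ext i j
  have h := congrFun (vecOf_bitsOfVec
    (fun q : Fin (l * m) => X (finProdFinEquiv.symm q).1 (finProdFinEquiv.symm q).2))
    (finProdFinEquiv (i, j))
  simp only [Equiv.symm_apply_apply] at h
  rw [← h]
  simp only [ofBits_apply, vecOf, bitsOfMat, pos_eq]

/-- A statement about all `l × m` matrices over `𝔽₂` is a statement about all `x < 2 ^ (l m)`. -/
theorem forall_matrix_iff {l m : ℕ} (P : Matrix (Fin l) (Fin m) (ZMod 2) → Prop) :
    (∀ X, P X) ↔ ∀ x < 2 ^ (l * m), P (ofBits l m x) :=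
  ⟨fun h x _ => h _, fun h X => by rw [← ofBits_bitsOfMat X]; exact h _ (bitsOfMat_lt X)⟩

/-- Sums over the entries of an `l × m` matrix are sums over bit positions `< l m`. -/
theorem sum_sum_eq_sum_range {M : Type*} [AddCommMonoid M] (l m : ℕ) (g : ℕ → M) :
    (∑ i : Fin l, ∑ j : Fin m, g (pos m i j)) = ∑ p ∈ Finset.range (l * m), g p := by
  rw [← Finset.sum_product', ← Fin.sum_univ_eq_sum_range]
  exact Finset.sum_equiv finProdFinEquiv (by simp) (by rintro ⟨i, j⟩ -; rw [pos_eq])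

/-! ## Linear forms -/

/-- The linear form on `l × m` matrices with bit pattern `κ`: `X ↦ ∑_{(i,j) : bit (j + m i) of κ} X i j`. -/
def form (l m : ℕ) (κ : ℕ) : Module.Dual (ZMod 2) (Matrix (Fin l) (Fin m) (ZMod 2)) :=
  ∑ i : Fin l, ∑ j : Fin m,
    if κ.testBit (pos m i j) then Matrix.entryLinearMap (ZMod 2) (ZMod 2) i j else 0

/-- Evaluation of `form`. -/
theorem form_apply (l m κ : ℕ) (X : Matrix (Fin l) (Fin m) (ZMod 2)) :
    form l m κ X = ∑ i : Fin l, ∑ j : Fin m, if κ.testBit (pos m i j) then X i j else 0 := by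
  simp only [form, LinearMap.coe_sum, Finset.sum_apply]
  refine Finset.sum_congr rfl fun i _ => Finset.sum_congr rfl fun j _ => ?_
  split <;> simp

/-- Parity of the common bits of `κ` and `x` below `N`. -/
def bdot (N κ x : ℕ) : Bool := bxor (fun p => κ.testBit p && x.testBit p) N

/-- Evaluating a form on an encoded matrix is the parity of the common bits. -/
theorem form_ofBits (l m κ x : ℕ) :
    form l m κ (ofBits l m x) = if bdot (l * m) κ x then 1 else 0 := by
  rw [form_apply, bdot, ← sum_ite_range]
  rw [← sum_sum_eq_sum_range l m (fun p => if (κ.testBit p && x.testBit p) then (1 : ZMod 2) else 0)]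
  refine Finset.sum_congr rfl fun i _ => Finset.sum_congr rfl fun j _ => ?_
  simp only [ofBits_apply]
  cases κ.testBit (pos m i j) <;> cases x.testBit (pos m i j) <;> simp

/-- `form l m κ (ofBits l m x) = 0 ↔ bdot (l m) κ x = false`. -/
theorem form_ofBits_eq_zero_iff (l m κ x : ℕ) :
    form l m κ (ofBits l m x) = 0 ↔ bdot (l * m) κ x = false := by
  rw [form_ofBits]
  cases bdot (l * m) κ x <;> simp

/-- The bit pattern of a linear form: its values on the standard basis. -/
noncomputable def bitsOfForm {l m : ℕ} (g : Module.Dual (ZMod 2) (Matrix (Fin l) (Fin m) (ZMod 2))) : ℕ :=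
  bitsOfMat (Matrix.of fun i j => g (Matrix.single i j 1))

/-- Every linear form is the form of its bit pattern. -/
theorem form_bitsOfForm {l m : ℕ} (g : Module.Dual (ZMod 2) (Matrix (Fin l) (Fin m) (ZMod 2))) :
    form l m (bitsOfForm g) = g := by
  -- the matrix of values of `g` on the standard basis
  set G : Matrix (Fin l) (Fin m) (ZMod 2) := Matrix.of fun i j => g (Matrix.single i j 1) with hG
  have hbits : ∀ (i : Fin l) (j : Fin m), ((bitsOfForm g).testBit (pos m i j) = true ↔ G i j = 1) := by
    intro i j
    have h := congrFun (congrFun (ofBits_bitsOfMat G) i) j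
    simp only [ofBits_apply] at h
    rw [bitsOfForm, ← hG]
    constructor
    · intro hb; rw [hb] at h; simpa using h.symm
    · intro h1
      by_contra hb
      rw [Bool.not_eq_true] at hb
      rw [hb, h1] at h
      simp at h
  apply LinearMap.ext
  intro X
  rw [form_apply]
  conv_rhs => rw [Matrix.matrix_eq_sum_single X, map_sum]
  refine Finset.sum_congr rfl fun i _ => ?_
  rw [map_sum]
  refine Finset.sum_congr rfl fun j _ => ?_
  have hs : Matrix.single i j (X i j) = X i j • Matrix.single i j (1 : ZMod 2) := by
    ext a b
    simp [Matrix.single, Matrix.of_apply]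
  rw [hs, map_smul, smul_eq_mul]
  have hGij : g (Matrix.single i j 1) = G i j := by simp [hG]
  rw [hGij]
  by_cases hb : (bitsOfForm g).testBit (pos m i j) = true
  · rw [if_pos hb, (hbits i j).1 hb, mul_one]
  · rw [if_neg hb]
    rcases zmod2_eq_zero_or_one (G i j) with h0 | h1
    · rw [h0, mul_zero]
    · exact absurd ((hbits i j).2 h1) hb

/-- `bitsOfForm g < 2 ^ (l m)`. -/
theorem bitsOfForm_lt {l m : ℕ} (g : Module.Dual (ZMod 2) (Matrix (Fin l) (Fin m) (ZMod 2))) :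
    bitsOfForm g < 2 ^ (l * m) := bitsOfMat_lt _

/-- A statement about all linear forms on `l × m` matrices over `𝔽₂` is a statement about all
`κ < 2 ^ (l m)`. -/
theorem forall_dual_iff {l m : ℕ} (P : Module.Dual (ZMod 2) (Matrix (Fin l) (Fin m) (ZMod 2)) → Prop) :
    (∀ g, P g) ↔ ∀ κ < 2 ^ (l * m), P (form l m κ) :=
  ⟨fun h κ _ => h _, fun h g => by rw [← form_bitsOfForm g]; exact h _ (bitsOfForm_lt g)⟩

/-- Forms are additive in the bit pattern (`xor`). -/
theorem form_xor (l m a b : ℕ) : form l m (a ^^^ b) = form l m a + form l m b := by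
  apply LinearMap.ext
  intro X
  rw [LinearMap.add_apply, form_apply, form_apply, form_apply, ← Finset.sum_add_distrib]
  refine Finset.sum_congr rfl fun i _ => ?_
  rw [← Finset.sum_add_distrib]
  refine Finset.sum_congr rfl fun j _ => ?_
  rw [Nat.testBit_xor]
  have h2 : X i j + X i j = 0 := by
    rw [← two_smul ℕ (X i j)]
    rcases zmod2_eq_zero_or_one (X i j) with h | h <;> rw [h] <;> decide
  cases a.testBit (pos m i j) <;> cases b.testBit (pos m i j) <;> simp [h2]

/-! ## Matrix products in bits -/

/-- Bits of the product of an `l × m` and an `m × n` matrix over `𝔽₂`. -/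
def mulBits (l m n : ℕ) (x y : ℕ) : ℕ :=
  maskOf (fun p => bxor (fun a => x.testBit (pos m (p / n) a) && y.testBit (pos n a (p % n))) m)
    (l * n)

/-- `mulBits` encodes the matrix product. -/
theorem ofBits_mulBits (l m n x y : ℕ) :
    ofBits l n (mulBits l m n x y) = ofBits l m x * ofBits m n y := by
  ext i k
  rw [Matrix.mul_apply]
  simp only [ofBits_apply, mulBits, testBit_maskOf]
  have hp : pos n i k < l * n := by
    have := (finProdFinEquiv (i, k)).2
    rwa [← pos_eq] at this
  have hn : 0 < n := Nat.pos_of_ne_zero fun h => by subst h; exact absurd k.2 (by simp)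
  have hdiv : pos n i k / n = i := by
    simp only [pos]
    rw [Nat.add_mul_div_left _ _ hn, Nat.div_eq_of_lt k.2, zero_add]
  have hmod : pos n i k % n = k := by
    simp only [pos]
    rw [Nat.add_mul_mod_self_left, Nat.mod_eq_of_lt k.2]
  simp only [hp, decide_true, Bool.true_and, hdiv, hmod]
  rw [← sum_ite_range, ← Fin.sum_univ_eq_sum_range]
  refine Finset.sum_congr rfl fun a _ => ?_
  cases x.testBit (pos m i a) <;> cases y.testBit (pos n a k) <;> simp

/-- The bits of the identity matrix. -/
def oneBits (l : ℕ) : ℕ := maskOf (fun p => p / l == p % l) (l * l)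

/-- `oneBits` encodes `1`. -/
theorem ofBits_oneBits (l : ℕ) : ofBits l l (oneBits l) = 1 := by
  ext i k
  simp only [ofBits_apply, oneBits, testBit_maskOf]
  have hp : pos l i k < l * l := by
    have := (finProdFinEquiv (i, k)).2
    rwa [← pos_eq] at this
  have hl : 0 < l := Nat.pos_of_ne_zero fun h => by subst h; exact absurd k.2 (by simp)
  have hdiv : pos l i k / l = i := by
    simp only [pos]; rw [Nat.add_mul_div_left _ _ hl, Nat.div_eq_of_lt k.2, zero_add]
  have hmod : pos l i k % l = k := by
    simp only [pos]; rw [Nat.add_mul_mod_self_left, Nat.mod_eq_of_lt k.2]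
  simp only [hp, decide_true, Bool.true_and, hdiv, hmod, Matrix.one_apply, Fin.ext_iff]
  by_cases h : (i : ℕ) = k <;> simp [h]

/-- Matrices with equal encodings below `2^(l m)`… rather: equal bit data give equal matrices
(trivial direction used by the checkers). -/
theorem ofBits_eq_one_of_mulBits_eq {l x y : ℕ} (h : mulBits l l l x y = oneBits l) :
    ofBits l l x * ofBits l l y = 1 := by
  rw [← ofBits_mulBits, h, ofBits_oneBits]

end Summit.MatrixMultiplication.OmegaCensus.GF2RankLB
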